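import Literature.AlgebraicGeometry.HodgeTheory.RegularFormRealization
import Literature.AlgebraicGeometry.HodgeTheory.HolomorphicBundleChernCharacterProofs
import Literature.AlgebraicGeometry.FundamentalGroup.RiemannExistenceCharPolyRegular
import Literature.AlgebraicGeometry.Motives.VarietiesGeometricallyIntegralProofs
import Literature.NumberTheory.Transcendental.AnalytificationConnectedProofs
import Literature.NumberTheory.Transcendental.ComplexFormsHighType
import HarnessLib

/-!
# Grothendieck's comparison map is bijective in degree `0` (and onto above the real dimension)

[topic AlgebraicGeometry/HodgeTheory]

Validation instances of `Literature.AlgebraicGeometry.HodgeTheory.deRhamComparison`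
(Grothendieck's map (5), `H^p(Γ(V(I), Ω•)) → H^p_dR(Y^an; ℂ)`, [Grothendieck1966, p. 96]): the
ranges of degrees in which Theorem 1′ ibid. (*"(5) is bijective"* for `Y` smooth affine, `φ_x`
onto, `I = ker φ_x`) is elementary, proved outright — for ANY coordinates `x : Fin N → Γ(Y, 𝒪)`
(no surjectivity of `φ_x : ℂ[T] → Γ(Y, 𝒪)` is needed in degree `0`):

* `deRhamComparison_surjective_degree_zero` — for `Y` affine, locally of finite type and
  CONNECTED (e.g. irreducible) and any ideal `I ⊆ ker φ_x`, every class in `H⁰_dR(Y^an; ℂ)` is in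
  the image: `Y^an ≃ₜ Y(ℂ)` is connected (SGA1 XII Prop. 2.4, `ComplexPoints.connectedSpace_iff_holds`),
  so a closed `0`-form is a constant `κ` (Warner 4.11), the holomorphic image of the closed regular
  `0`-form `κ · 1`;
* `regularFormRealize_injective_degree_zero` (cochain level) and
  `deRhamComparison_injective_degree_zero` — for `Y` affine, locally of finite type and REDUCED
  and `I = ker φ_x`: a regular `0`-form `f mod I` whose image `(φ_x f)^an` vanishes (in cohomology:
  has zero class — there are no exact `0`-forms) is `0`, because a regular function vanishing at
  every complex point of a reduced `ℂ`-scheme locally of finite type is zero (`Y` is Jacobson,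
  SGA1 XII Prop. 2.1 (i); `AnalyticModel.regularFun_eq_zero_iff`), so `φ_x f = 0`, i.e. `f ∈ I`;
* `deRhamComparison_bijective_degree_zero` — **Theorem 1′ in degree `0`**: for `Y` affine, smooth
  (hence reduced, Stacks 056T) and connected, `H⁰(Γ(V(ker φ_x), Ω•)) → H⁰_dR(Y^an; ℂ)` is
  bijective;
* `deRhamComparison_surjective_of_lt` — for `k > 2m = dim_ℝ Y^an` every complex `k`-form
  vanishes, so `Hᵏ_dR(Y^an; ℂ) = 0` is trivially covered.

## References

* [Grothendieck1966] A. Grothendieck, *On the de Rham cohomology of algebraic varieties*,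
  Publ. Math. IHÉS 29 (1966), p. 96 (5) and Thm 1′.
* [SGA1] A. Grothendieck, M. Raynaud, *Revêtements étales et groupe fondamental*, Exp. XII
  Prop. 2.1 (i) (closed points = `ℂ`-points are dense in constructible sets) and Prop. 2.4
  (`X` connected ⇔ `X^an` connected).
* [StacksProject] The Stacks Project, Tag 056T (smooth over a field ⇒ geometrically reduced).
* [WarnerGTM94] F. Warner, *Foundations of differentiable manifolds and Lie groups*, 4.11.
-/

noncomputable section

open scoped Manifold ContDiff
open CategoryTheory AlgebraicGeometry
open Literature.NumberTheory.Transcendental Literature.Geometry.Kaehler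
open Literature.AlgebraicGeometry.Motives Literature.AlgebraicGeometry.Motives.AffineDeRham

namespace Literature.AlgebraicGeometry.HodgeTheory

section HodgeTheory

variable {E : Type} [NormedAddCommGroup E] [NormedSpace ℂ E] [FiniteDimensional ℂ E] {m : ℕ}
  {Y : Motives.SchemeOver ℂ} {N : ℕ}

/-! ### Regular functions are detected on `Y^an` -/

/-- **A regular function on a reduced `ℂ`-scheme locally of finite type is determined by its
holomorphic image**: `s^an = 0` on `Y^an` iff `s = 0`. (`Y^an → Y(ℂ)` is onto, and a section
vanishing at every complex point of a reduced scheme locally of finite type over `ℂ` is zero —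
`CharPolyRegular.eq_zero_of_forall_eval_eq_zero`: `Y` is Jacobson, so `D(s)` would contain a closed
point.) [cite: SGA1, Exp. XII Prop. 2.1 (i)] -/
theorem AnalyticModel.regularFun_eq_zero_iff [LocallyOfFiniteType Y.hom] [IsReduced Y.left]
    (A : AnalyticModel E m Y) (s : Γ(Y.left, ⊤)) : A.regularFun s = 0 ↔ s = 0 := by
  refine ⟨fun h ↦ ?_, ?_⟩
  · refine Literature.AlgebraicGeometry.FundamentalGroup.CharPolyRegular.eq_zero_of_forall_eval_eq_zero
      s fun P hP ↦ ?_
    obtain ⟨z, rfl⟩ := A.homeomorph.surjective P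
    have hz : AlgPoints.evalOrZero ⊤ s (A.homeomorph z) = 0 := congrFun h z
    rwa [AlgPoints.evalOrZero_of_mem s hP] at hz
  · rintro rfl
    exact A.regularFun_zero

/-! ### Constants as closed regular `0`-forms -/

/-- The constant polynomial `κ` is a closed `0`-form on affine space (`dκ = 0`), hence on every
`V(I)`. [cite: Grothendieck1966, (4)] -/
theorem extDeriv_ofPoly_C (κ : ℂ) :
    AffineDeRham.extDeriv (ofPoly (MvPolynomial.C κ) : PolyForm ℂ N 0) = 0 := by
  ext v
  simp [extDeriv_ofPoly_apply, MvPolynomial.derivation_C]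

/-- The restriction of the constant `κ` to `V(I)` is a closed regular `0`-form. [cite: Grothendieck1966, (4)] -/
theorem mk_ofPoly_C_mem_closedForms (I : Ideal (MvPolynomial (Fin N) ℂ)) (κ : ℂ) :
    RegularForm.mk I (ofPoly (MvPolynomial.C κ)) ∈ closedForms I 0 := by
  rw [mk_mem_closedForms_iff, IsClosedOn, extDeriv_ofPoly_C]
  exact Submodule.zero_mem _

/-- The holomorphic image of the constant `κ` is the constant `0`-form `κ` on `Y^an`.
[cite: Grothendieck1966, (5)] -/
theorem polyFormRealize_ofPoly_C (A : AnalyticModel E m Y) (x : Fin N → Γ(Y.left, ⊤)) (κ : ℂ) :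
    polyFormRealize A x 0 (ofPoly (MvPolynomial.C κ)) = MForm.const 𝓘(ℝ, E) A.carrier κ := by
  rw [polyFormRealize_ofPoly, coordPresentation_C, AnalyticModel.regularFun_scalarRingHom]
  rfl

/-! ### Degree `0`: surjectivity (connected `Y`), injectivity (reduced `Y`), bijectivity -/

/-- **Theorem 1′ in degree `0`, surjectivity: for `Y` affine, locally of finite type and connected
the comparison map `H⁰(Γ(V(I), Ω•)) → H⁰_dR(Y^an; ℂ)` is onto** — for any coordinates `x` and any
ideal `I ⊆ ker φ_x`: `Y^an` is connected (SGA1 XII Prop. 2.4), so a closed `0`-form on it is a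
constant `κ` (Warner 4.11), the image of the closed regular `0`-form `κ · 1`. Irreducible `Y` are
connected (instance `IrreducibleSpace.connectedSpace`). [cite: Grothendieck1966, Thm 1']
[cite: SGA1, Exp. XII Prop. 2.4] -/
theorem deRhamComparison_surjective_degree_zero [IsAffine Y.left] [LocallyOfFiniteType Y.hom]
    [ConnectedSpace Y.left] (A : AnalyticModel E m Y) (x : Fin N → Γ(Y.left, ⊤))
    {I : Ideal (MvPolynomial (Fin N) ℂ)} (hI : I ≤ RingHom.ker (coordPresentation Y x)) :
    Function.Surjective (deRhamComparison A x hI 0) := by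
  haveI : ConnectedSpace (Motives.ComplexPoints Y) :=
    (Motives.ComplexPoints.connectedSpace_iff_holds Y).mpr ‹_›
  haveI : ConnectedSpace A.carrier :=
    A.homeomorph.symm.surjective.connectedSpace A.homeomorph.symm.continuous
  intro c
  obtain ⟨α, rfl⟩ := complexDeRhamCohomology.mk_surjective c
  -- the value of the (constant) closed `0`-form `α`
  obtain ⟨κ, hκ⟩ : ∃ κ : ℂ, (α : MForm 𝓘(ℝ, E) A.carrier ℂ 0) = MForm.const 𝓘(ℝ, E) A.carrier κ := by
    rcases isEmpty_or_nonempty A.carrier with hA | ⟨⟨z₀⟩⟩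
    · exact ⟨0, funext fun z ↦ isEmptyElim z⟩
    · obtain ⟨hs, hc⟩ := (mem_cclosedSmoothForms_iff (α : MForm 𝓘(ℝ, E) A.carrier ℂ 0)).1 α.2
      exact ⟨α.1 z₀ ![], eq_const_of_isClosedForm_zero hs hc z₀⟩
  refine ⟨DeRhamCohomology.mk I ⟨RegularForm.mk I (ofPoly (MvPolynomial.C κ)),
    mk_ofPoly_C_mem_closedForms I κ⟩, ?_⟩
  rw [deRhamComparison_mk]
  congr 1
  refine Subtype.ext ?_
  change regularFormRealize A x hI 0 (RegularForm.mk I (ofPoly (MvPolynomial.C κ))) =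
    (α : MForm 𝓘(ℝ, E) A.carrier ℂ 0)
  rw [regularFormRealize_mk, polyFormRealize_ofPoly_C, hκ]

/-- **The holomorphic image is faithful on regular `0`-forms** (cochain level, degree `0`): for `Y`
affine, locally of finite type and reduced, and `I = ker φ_x` (any coordinates `x`), the map
`Γ(V(I), 𝒪) = Ω⁰(V(I)) → A⁰(Y^an)`, `f mod I ↦ (φ_x f)^an`, is injective — `(φ_x f)^an = 0` forces
`φ_x f = 0` (`AnalyticModel.regularFun_eq_zero_iff`), i.e. `f ∈ I`. [cite: Grothendieck1966, (5)]
[cite: SGA1, Exp. XII Prop. 2.1 (i)] -/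
theorem regularFormRealize_injective_degree_zero [IsAffine Y.left] [LocallyOfFiniteType Y.hom]
    [IsReduced Y.left] (A : AnalyticModel E m Y) (x : Fin N → Γ(Y.left, ⊤))
    {I : Ideal (MvPolynomial (Fin N) ℂ)} (hI : I = RingHom.ker (coordPresentation Y x)) :
    Function.Injective (regularFormRealize A x hI.le 0) := by
  refine (injective_iff_map_eq_zero _).2 fun r hr ↦ ?_
  obtain ⟨f, rfl⟩ : ∃ f : MvPolynomial (Fin N) ℂ, RegularForm.mk I (ofPoly f) = r := by
    obtain ⟨α, hα⟩ := RegularForm.mk_surjective I r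
    exact ⟨ofPoly.symm α, by rwa [LinearEquiv.apply_symm_apply]⟩
  -- `(φ_x f)^an = 0` on `Y^an`
  have h1 : A.regularFun (coordPresentation Y x f) = 0 := by
    rw [regularFormRealize_mk, polyFormRealize_ofPoly] at hr
    funext z
    simpa using DFunLike.congr_fun (congrFun hr z) ![]
  -- hence `φ_x f = 0`, i.e. `f ∈ I = ker φ_x`, i.e. `f mod I = 0`
  rw [RegularForm.mk_eq_zero_iff, ofPoly_mem_vanishingForms_iff, hI, RingHom.mem_ker]
  exact (A.regularFun_eq_zero_iff _).1 h1

/-- **Theorem 1′ in degree `0`, injectivity: for `Y` affine, locally of finite type and reduced, and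
`I = ker φ_x` (any coordinates `x`), the comparison map `H⁰(Γ(V(I), Ω•)) → H⁰_dR(Y^an; ℂ)` is
injective**: a closed regular `0`-form whose holomorphic image has zero class has zero image
(there are no exact `0`-forms on `Y^an`), hence is zero (`regularFormRealize_injective_degree_zero`).
[cite: Grothendieck1966, Thm 1'] [cite: SGA1, Exp. XII Prop. 2.1 (i)] -/
theorem deRhamComparison_injective_degree_zero [IsAffine Y.left] [LocallyOfFiniteType Y.hom]
    [IsReduced Y.left] (A : AnalyticModel E m Y) (x : Fin N → Γ(Y.left, ⊤))
    {I : Ideal (MvPolynomial (Fin N) ℂ)} (hI : I = RingHom.ker (coordPresentation Y x)) :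
    Function.Injective (deRhamComparison A x hI.le 0) := by
  refine (injective_iff_map_eq_zero _).2 fun c hc ↦ ?_
  obtain ⟨r, rfl⟩ := DeRhamCohomology.mk_surjective I c
  -- the holomorphic image of `r` vanishes: there are no exact `0`-forms on `Y^an`
  have h0 : regularFormRealize A x hI.le 0 r = 0 := by
    rw [deRhamComparison_mk, ← (complexDeRhamCohomology.mk E A.carrier 0).map_zero,
      complexDeRhamCohomology.mk_eq_mk_iff, Submodule.coe_zero, sub_zero, cexactSmoothForms,
      Submodule.mem_bot] at hc
    exact hc
  -- hence `r = 0`, which is exact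
  have hr : (r : RegularForm I 0) = 0 :=
    regularFormRealize_injective_degree_zero A x hI (by rw [h0, map_zero])
  refine (DeRhamCohomology.mk_eq_zero_iff I r).2 ?_
  rw [hr]
  exact Submodule.zero_mem _

/-- **Theorem 1′ in degree `0`** [Grothendieck1966, p. 96]: for `Y` affine, smooth (of some
relative dimension `m`; hence reduced, Stacks 056T) and connected, and any coordinates `x`, the
comparison map `H⁰(Γ(V(ker φ_x), Ω•)) → H⁰_dR(Y^an; ℂ)` is **bijective**.
[cite: Grothendieck1966, Thm 1'] [cite: StacksProject, Tag 056T] -/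
theorem deRhamComparison_bijective_degree_zero [IsAffine Y.left] [SmoothOfRelativeDimension m Y.hom]
    [ConnectedSpace Y.left] (A : AnalyticModel E m Y) (x : Fin N → Γ(Y.left, ⊤)) :
    Function.Bijective (deRhamComparison A x (le_rfl : RingHom.ker (coordPresentation Y x) ≤ _) 0) := by
  haveI : Smooth Y.hom := SmoothOfRelativeDimension.smooth m Y.hom
  haveI : IsReduced Y.left := Motives.isReduced_of_smooth_over_field Y.hom
  exact ⟨deRhamComparison_injective_degree_zero A x rfl,
    deRhamComparison_surjective_degree_zero A x le_rfl⟩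

/-- The requested validation row V-B24 as displayed (TRIBUNAL-B v5 addendum): for `Y` affine, smooth
and irreducible, `(5)` is onto in degree `0` for `I = ker φ_x` — a special case of
`deRhamComparison_surjective_degree_zero` (no surjectivity of `φ_x` is needed).
[cite: Grothendieck1966, Thm 1'] -/
theorem deRhamComparison_surjective_degree_zero_ker [IsAffine Y.left]
    [SmoothOfRelativeDimension m Y.hom] [IrreducibleSpace Y.left] (A : AnalyticModel E m Y)
    (x : Fin N → Γ(Y.left, ⊤)) :
    Function.Surjective (deRhamComparison A x (le_rfl : RingHom.ker (coordPresentation Y x) ≤ _) 0) :=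
  (deRhamComparison_bijective_degree_zero A x).2

/-! ### Degrees above the real dimension -/

/-- **Theorem 1′ above the real dimension, surjectivity: for `k > 2m` the comparison map
`Hᵏ(Γ(V(I), Ω•)) → Hᵏ_dR(Y^an; ℂ)` is onto** — every complex `k`-form on `Y^an` vanishes.
[cite: Grothendieck1966, Thm 1'] -/
theorem deRhamComparison_surjective_of_lt [IsAffine Y.left] (A : AnalyticModel E m Y)
    (x : Fin N → Γ(Y.left, ⊤)) {I : Ideal (MvPolynomial (Fin N) ℂ)}
    (hI : I ≤ RingHom.ker (coordPresentation Y x)) {k : ℕ} (hk : 2 * m < k) :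
    Function.Surjective (deRhamComparison A x hI k) := by
  intro c
  obtain ⟨α, rfl⟩ := complexDeRhamCohomology.mk_surjective c
  have hk' : 2 * Module.finrank ℂ E < k := by rw [A.isAnalytification.finrank_eq]; exact hk
  have hα : α = 0 :=
    Subtype.ext (mform_eq_zero_of_two_mul_finrank_lt (α : MForm 𝓘(ℝ, E) A.carrier ℂ k) hk')
  exact ⟨0, by rw [map_zero, hα, map_zero]⟩

/-- Above the real dimension the target is zero, so the comparison map is the zero map onto
`Hᵏ_dR(Y^an; ℂ) = 0`. [cite: Grothendieck1966, Thm 1'] -/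
theorem subsingleton_complexDeRhamCohomology_of_lt (A : AnalyticModel E m Y) {k : ℕ}
    (hk : 2 * m < k) : Subsingleton (complexDeRhamCohomology E A.carrier k) := by
  refine ⟨fun c₁ c₂ ↦ ?_⟩
  obtain ⟨α₁, rfl⟩ := complexDeRhamCohomology.mk_surjective c₁
  obtain ⟨α₂, rfl⟩ := complexDeRhamCohomology.mk_surjective c₂
  have hk' : 2 * Module.finrank ℂ E < k := by rw [A.isAnalytification.finrank_eq]; exact hk
  have h₁ : α₁ = 0 :=
    Subtype.ext (mform_eq_zero_of_two_mul_finrank_lt (α₁ : MForm 𝓘(ℝ, E) A.carrier ℂ k) hk')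
  have h₂ : α₂ = 0 :=
    Subtype.ext (mform_eq_zero_of_two_mul_finrank_lt (α₂ : MForm 𝓘(ℝ, E) A.carrier ℂ k) hk')
  rw [h₁, h₂]

end HodgeTheory

end Literature.AlgebraicGeometry.HodgeTheory

end
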